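import Mathlib
import Summits.Ventures.HodgeRepro2.WeilVector
import Summits.Ventures.HodgeRepro2.A2ModelDuality

/-!
# A2 annex — the Pontryagin product `y = z ⋆ θ⁴` as a class of the model, and its Weil coordinates

Sub-claim A2 (route/T4-A2-p6.md v6, (A4.3.3)) defines the Pontryagin product
`a ⋆ b := m_*(pr₁^* a ∪ pr₂^* b) = m_*(a ⊗ b)` (the Gysin push-forward along the sum map
`m : B × B → B`) and the class `y := z ⋆ θ⁴ ∈ H⁴(B, ℚ)` of Theorem A ((S3)); by Lemma A4.1.1 (ii)
`⟨a ⋆ b, u⟩ = ∫_{B × B} (a ⊗ b) ∪ m^* u`.  In p5's twelve-plane model (`WeilPairing`: `II = ∫_B ⊗ ∫_B`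
on `AA ι = A ι ᵍ⊗ A ι`, `inl z * inr v = z ⊗ v`, `cop = Δ = m^*`) the right-hand side is
`II (inl a * inr b * cop u)`, and p5's `pairing_identity_weil` (Proposition A5.5 of sub-claim A3)
computes it for `a = z`, `b = θ^{|P₀|}`, `u = θ^{|I_σ|} ∧ w_σ`.  With Poincaré duality of the model
(`A2ModelDuality.dualOf`) the Pontryagin product becomes a DEFINITION:

* `pontryaginFunctional a b` (`u ↦ II (inl a * inr b * cop u)`, the model of `∫_{B×B} (a ⊗ b) ∪ m^* u`),
* **`pontryagin a b := dualOf (pontryaginFunctional a b)`** (`= a ⋆ b`: A4.1.0's `PD^{-1} ∘ m_*^{hom} ∘ PD`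
  applied to `a ⊗ b`), `integral_pontryagin_mul` (Lemma A4.1.1 (ii) for `m`: `∫_B (a ⋆ b) ∧ u =
  ∫_{B×B} (a ⊗ b) ∪ m^* u`), `pontryagin_unique`;
* `pontryagin_add_left` / `_smul_left` / `_add_right` / `_smul_right` (bilinearity), and the
  correspondence `T_γ(u) := z ⋆ (θ³ ∪ u)` of (S4) (ii) with **`correspondence_theta`**: `y = T_γ(θ)`;
* **`integral_pontryagin_theta_pow_mul_weil`** (Prop. A5.5 for the class `y = z ⋆ θ^{|P₀|}` itself):
  `∫_B y ∧ θ^{|I_σ|} ∧ w_σ = |I_σ|! · |P₀|! · (∏ c) · vol · ∫_B z ∧ w_σ` — the Weil coordinates of `y`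
  are the surface periods `∫_B z ∧ w_σ = ∫_S f^* w_σ` (Lemma A4.1.1 (ii) for `f`, prose) up to the
  non-zero constant `|I_σ|! |P₀|! (∏ c) vol`; **`integral_pontryagin_theta_pow_mul_weil_ne_zero_iff`**:
  the coordinate is non-zero iff the period is (all `c_p ≠ 0`) — exactly where the input (N) enters.

What stays prose: the identification of the model with `H^*(B, ℂ)`, `∫_B z ∧ w_σ = ∫_S f^* w_σ`
(A4.1.1), and everything geometric.  Seat p6 (A2 owner), gen 16.
§8 (d): uses an L-value-free non-vanishing device: NO.
-/

namespace Summit.Ventures.HodgeRepro2.A2PontryaginModel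

open WeilPlanes WeilIntegral WeilDetect WeilCoproduct WeilPairing A2ModelDuality

variable {ι : Type*} [DecidableEq ι] [Fintype ι]

/-- The functional `u ↦ ∫_{B × B} (a ⊗ b) ∪ m^* u` of the model: `II (inl a * inr b * cop u)`. -/
noncomputable def pontryaginFunctional (a b : A ι) : A ι →ₗ[ℂ] ℂ :=
  II ∘ₗ LinearMap.mulLeft ℂ (inl a * inr b) ∘ₗ cop.toLinearMap

/-- Unfolding `pontryaginFunctional`. -/
@[simp] theorem pontryaginFunctional_apply (a b u : A ι) :
    pontryaginFunctional a b u = II (inl a * inr b * cop u) := rfl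

/-- The Pontryagin product `a ⋆ b = m_*(a ⊗ b)` of the model: the Poincaré dual of
`u ↦ ∫_{B × B} (a ⊗ b) ∪ m^* u` (A4.1.0, (A4.3.3)). -/
noncomputable def pontryagin (a b : A ι) : A ι := dualOf (pontryaginFunctional a b)

/-- Lemma A4.1.1 (ii) for the sum map, in the model: `∫_B (a ⋆ b) ∧ u = ∫_{B × B} (a ⊗ b) ∪ m^* u`. -/
theorem integral_pontryagin_mul (a b u : A ι) :
    integral (pontryagin a b * u) = II (inl a * inr b * cop u) :=
  integral_dualOf_mul _ u

/-- The Pontryagin product is the unique class with that pairing. -/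
theorem pontryagin_unique (a b : A ι) {y : A ι} (hy : ∀ u, integral (y * u) = II (inl a * inr b * cop u)) :
    y = pontryagin a b :=
  dualOf_unique _ hy

/-- The constant of Proposition A5.5: `|I_σ|! · |P₀|! · ∏ c · vol`. -/
noncomputable def weilConstant (P₀ : Finset ι) (c : ι → ℂ) : ℂ :=
  (((Finset.univ \ P₀).card.factorial : ℂ) * (P₀.card.factorial : ℂ) * ∏ p, c p) * vol ι

/-- The constant is non-zero when all `c_p ≠ 0` (`vol ≠ 0`, factorials `≠ 0`). -/
theorem weilConstant_ne_zero (P₀ : Finset ι) (c : ι → ℂ) (hc : ∀ p, c p ≠ 0) :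
    weilConstant P₀ c ≠ 0 := by
  unfold weilConstant
  refine mul_ne_zero (mul_ne_zero (mul_ne_zero ?_ ?_) ?_) (vol_ne_zero ι)
  · exact Nat.cast_ne_zero.mpr (Nat.factorial_ne_zero _)
  · exact Nat.cast_ne_zero.mpr (Nat.factorial_ne_zero _)
  · exact Finset.prod_ne_zero_iff.mpr fun p _ => hc p

/-- **Proposition A5.5 for the class `y = z ⋆ θ^{|P₀|}` of Theorem A.**  Its Weil coordinate against
`θ^{|I_σ|} ∧ w_σ` is the surface period `∫_B z ∧ w_σ` times the constant `|I_σ|! |P₀|! (∏ c) vol`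
(p5's `pairing_identity_weil` read through Lemma A4.1.1 (ii) for `m`). -/
theorem integral_pontryagin_theta_pow_mul_weil (P₀ : Finset ι) (s : Bool) (c : ι → ℂ) (z : A ι) :
    integral (pontryagin z (theta c ^ P₀.card) *
      (theta c ^ (Finset.univ \ P₀).card * weil P₀ s)) =
      weilConstant P₀ c * integral (z * weil P₀ s) := by
  rw [integral_pontryagin_mul, WeilVector.pairing_identity_weil, weilConstant]

/-- The Weil coordinate of `y = z ⋆ θ^{|P₀|}` is non-zero iff the period `∫_B z ∧ w_σ` is
(all `c_p ≠ 0`): the point at which the non-vanishing input (N) enters the transfer. -/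
theorem integral_pontryagin_theta_pow_mul_weil_ne_zero_iff (P₀ : Finset ι) (s : Bool) (c : ι → ℂ)
    (hc : ∀ p, c p ≠ 0) (z : A ι) :
    integral (pontryagin z (theta c ^ P₀.card) *
      (theta c ^ (Finset.univ \ P₀).card * weil P₀ s)) ≠ 0 ↔
      integral (z * weil P₀ s) ≠ 0 := by
  rw [integral_pontryagin_theta_pow_mul_weil, mul_ne_zero_iff]
  exact ⟨fun h => h.2, fun h => ⟨weilConstant_ne_zero P₀ c hc, h⟩⟩

/-- The Pontryagin product is bilinear in the first variable (additivity). -/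
theorem pontryagin_add_left (a a' b : A ι) :
    pontryagin (a + a') b = pontryagin a b + pontryagin a' b := by
  symm
  apply pontryagin_unique
  intro u
  rw [add_mul, map_add, integral_pontryagin_mul, integral_pontryagin_mul, map_add, add_mul,
    add_mul, map_add]

/-- The Pontryagin product is bilinear in the first variable (scalars). -/
theorem pontryagin_smul_left (r : ℂ) (a b : A ι) :
    pontryagin (r • a) b = r • pontryagin a b := by
  symm
  apply pontryagin_unique
  intro u
  rw [smul_mul_assoc, map_smul, integral_pontryagin_mul, map_smul, smul_mul_assoc, smul_mul_assoc,
    map_smul]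

/-- The Pontryagin product is bilinear in the second variable (additivity). -/
theorem pontryagin_add_right (a b b' : A ι) :
    pontryagin a (b + b') = pontryagin a b + pontryagin a b' := by
  symm
  apply pontryagin_unique
  intro u
  rw [add_mul, map_add, integral_pontryagin_mul, integral_pontryagin_mul, map_add, mul_add,
    add_mul, map_add]

/-- The Pontryagin product is bilinear in the second variable (scalars). -/
theorem pontryagin_smul_right (r : ℂ) (a b : A ι) :
    pontryagin a (r • b) = r • pontryagin a b := by
  symm
  apply pontryagin_unique
  intro u
  rw [smul_mul_assoc, map_smul, integral_pontryagin_mul, map_smul, mul_smul_comm, smul_mul_assoc,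
    map_smul]

/-- The correspondence `T_γ(u) := z ⋆ (θ³ ∪ u)` of (S4) (ii) / Proposition A4.4.1 (ii), in the model
(`γ = φ_*(z ⊗ θ³)`, `T_γ(u) = pr_{2*}(γ ∪ pr_1^* u)`, prose). -/
noncomputable def correspondence (z : A ι) (c : ι → ℂ) (u : A ι) : A ι :=
  pontryagin z (theta c ^ 3 * u)

/-- `y = T_γ(θ)`: the class `y = z ⋆ θ⁴` of Theorem A is the image of the `(1,1)`-class `θ` under the
correspondence `T_γ` ((S4) (ii)). -/
theorem correspondence_theta (z : A ι) (c : ι → ℂ) :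
    correspondence z c (theta c) = pontryagin z (theta c ^ 4) := by
  rw [correspondence, ← pow_succ]

/-- `T_γ` is additive in `u`. -/
theorem correspondence_add (z : A ι) (c : ι → ℂ) (u u' : A ι) :
    correspondence z c (u + u') = correspondence z c u + correspondence z c u' := by
  rw [correspondence, correspondence, correspondence, mul_add, pontryagin_add_right]

end Summit.Ventures.HodgeRepro2.A2PontryaginModel
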